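import Summits.QuantumFields.YangMills.Theorems.BalabanUVNodesN07SplitClauseHeadKnitMeet
import HarnessLib

/-!
# N07 [B11] (= [15] = [Balaban1985Variational]) Sect. F, S6 HEAD — **THE OUTWARD MEET EDITION, FILE I: THE KNIT AT THE GRID GUARD `A‴(c, c₀, c₁)`** (the V21-G CANDIDATE text of plan
# g86 I.40244 (3) ∕ k0-s1-w3 FILE 4‴ `h1G` ∕ n07-e CLAIM-58: `c ≤ ν.M₁ ∧ k + c₀ ≤ F.m + K ∧ F.L ^ c₁ ∣ M ∧ ∀ i ≤ k, dCubeSide L M R_i i ∣ sitesPerDir 0`): FILE D's guard-generic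
# [15] Prop. 8 step token with its two guard hypotheses DISCHARGED at `A‴` — conjuncts 1–2 verbatim; `hgran` from conjunct 3 (`L·M_h = L·L^{a′} ∣ L^{c₁} ∣ M ∣ M·R_j`, side letter
# `a′ + 1 ≤ c₁`; k0-s1-w3's `hgran_of_pow_dvd` inlined); `hdiv` = conjunct 4 — and the candidate stub-1 SHAPE `∃ c c₀ c₁ B₃ a₀ a₁, …`

Cell `pub-ymgap`, width seat `pub-ymgap-dag-n07-w4` g5 (S6 HEAD), INTENT-9 (cell bus).  `--kind proof --supports stmt-QuantumFields-27364 --as helper` (K1⁹); count-neutral; def-free.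
The guard lambda is k0-s1-w3's `K0Stub1GridNumericsGuardWitness` :147–150 text VERBATIM; NOTHING is registered by this file (V20-G dead8a8df885c226 of record, frozen №223).

WHAT IS PROVED (sorry-free; no definition; axioms standard).  ★★★ `prop8RegSepTopStepG_gridGuard_of_prop6P_of_chartMeet F N` — `Prop8RegSepTopStepG F N suppDom (A‴ c c₀ c₁) B₃ a₀ a₁`
modulo [6] Prop. 6, HCHART-MEET (FILE D's, with the grid guard as its antecedent), the ranged HLETTERS ∕ HBUDGET, `2L² ≤ B₃` + smallness, structural letters + `a′ + 1 ≤ c₁`;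
★★★ `prop8StepCoPGridGuardShape_of_prop6P_of_chartMeet F N` — the ∃-shape over `(c, c₀, c₁, B₃, a₀, a₁)` (`0 < a₀`, `0 < a₁` displayed).
HONEST SCOPE.  Count-neutral specialisation of FILE D; every displayed binder a hypothesis (hP6, HCHART-MEET, HLETTERS∕HBUDGET — LOCATED-BUDGET-SHEAR-THETA applies —, smallness); joint
satisfiability NOT claimed; NO stub registered or closed; nothing of [15]∕[6] analysis asserted; stub 1-G ∕ K0⁷ ∕ K1⁹ NOT closed; N07 ∕ N05 NOT discharged; counts unmoved (typed 28∕28 ·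
discharged 5∕27); one finite 𝕋⁴ programme at fixed ε — the route closes the conditional finite-𝕋⁴ rung `BalabanLadder.UV` ONLY; the YM mass gap (Clay) is NOT proved by any of this.
No `sorry` ∕ `def` ∕ `instance` ∕ `notation`.

References: [15] Prop. 8 p. 304, (150) p. 301, (162)–(168) pp. 303–304; [6] Prop. 6 p. 99; [Balaban1988Convergent] (2.1) p. 254, (2.5) p. 255; [Balaban1987RG1] (0.1) p. 251.
-/

set_option autoImplicit false

noncomputable section
open scoped BigOperators Matrix.Norms.L2Operator

namespace Summit.QuantumFields.YangMills.BalabanUVNodes.N07SplitClauseHeadKnitMeetGridGuard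

open Literature.MathematicalPhysics.QuantumFieldTheory.Balaban1983to89
open Literature.MathematicalPhysics.QuantumFieldTheory.Balaban1983to89.Node00
open Literature.MathematicalPhysics.QuantumFieldTheory.Balaban1983to89.B15DeterminingSets
open Literature.MathematicalPhysics.QuantumFieldTheory.Balaban1983to89.B12RegularSpaces111 (gaugeU expI grad)
open B15Eq112TorusCover (cover)
open B14DomainGeom (Pt Within)
open B14.Eq213MaximalDomains (side cubeExt)
open B5Eq117TorusCarriers (Mk)
open B5Eq118OneStroke (iterBlockOf)
open B5Prop12FieldsLattice (distSite)
open B8Eq131Cubes (sqLo sqHi box cube)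
open B8LeafModelZd (ZdIdx)
open B6SectADomainsV1 (Domains)
open B6SectAOperatorsV1 (BondIdx RE dsE QpE)
open Literature.MathematicalPhysics.QuantumFieldTheory.BalabanImbrieJaffe1984to88.BIJ85AxialPropagator411 (BondSpace)
open T4Continuum (T4Family)
open T4AxialGaugeSmallField (castSite)
open B16Sect1Backgrounds (toMS)
open GaugeField (gaugeAct)
open MatrixLog (mlog)
open Summit.QuantumFields.YangMills.Theorems.K0FlatCubeOpsTextP (flatH)
open Summit.QuantumFields.YangMills.BalabanUVNodes.N07HalvingStepTopOfLocalLetters (Letters10On)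
open Summit.QuantumFields.YangMills.BalabanUVNodes.N07SplitClauseHeadKnitMeet (prop8RegSepTopStepG_of_prop6P_of_chartMeet)

open scoped Classical in
/-- ★★★ **THE GUARDED [15] PROP. 8 STEP TOKEN AT THE GRID GUARD `A‴(c, c₀, c₁)`** — FILE D's `prop8RegSepTopStepG_of_prop6P_of_chartMeet` with the two guard hypotheses discharged
(conjuncts 1–2; `hgran` from `F.L^{c₁} ∣ M` and `a′ + 1 ≤ c₁`; `hdiv` = conjunct 4).  Everything else displayed as in FILE D.
[cite: Balaban1985Variational, Prop. 8 p.304, (150) p.301, (162)–(168) pp.303–304; Balaban1985RegularSpaces, Prop. 6 p.99, (1.3)–(1.9) p.77; Balaban1988Convergent, (2.1) p.254, (2.5) p.255; Balaban1987RG1, (0.1) p.251] -/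
theorem prop8RegSepTopStepG_gridGuard_of_prop6P_of_chartMeet (F : T4Family) (N : ℕ) [NeZero N] :
    ∃ (Mh₀ R₀ : ℕ) (CS BS CH δH BH : ℝ), 0 ≤ CS ∧ 0 < BS ∧ 0 ≤ CH ∧ 0 < δH ∧ 0 < BH ∧
    ∀ {B₁ c₁ : ℝ} (_ : 0 ≤ B₁) (_ : 0 < c₁) {ρ : ℕ}
      (_ : letI : CStarAlgebra (MatA N) := {}; B8.Prop6Printed 4 (F.L : ℝ) B₁ c₁ (fun i : ZdIdx 4 F.L => zdCubP (MatA N) F.L ρ i))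
      -- structural letters: grid cube `Mc`, block height `a′` (`M_h = L^{a′} ≥ M_h⁰`), `R ≥ R₀`, the collar `ρ` with `L·M_h ∣ ρ`, `R·L·M_h ≤ ρ`, `L ≤ ρ`
      {Mc Mh R a' : ℕ} (_ : 1 ≤ Mc) (_ : Mc ≤ ρ) (_ : Mh = F.L ^ a') (_ : Mh₀ ≤ Mh) (_ : R₀ ≤ R) (_ : F.L * Mh ∣ ρ) (_ : R * (F.L * Mh) ≤ ρ) (hLρ : F.L ≤ ρ)
      -- the two constants of the plan's V20-G guard `c ≤ ν.M₁ ∧ k + c₀ ≤ F.m + K` and their side conditions, stated once (n07-w3 g7's two + the head's two)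
      {c c₀ : ℕ} (_ : (11 * 4 + 4 * ρ + Mc + 3) * F.L ≤ c) (_ : Mc + 11 * 4 + 6 * ρ ≤ 2 * F.L ^ c₀) (_ : F.m ≤ c₀) (_ : a' + 3 ≤ c₀)
      -- ★ THE GRID GUARD's third constant `c₁` (candidate conjunct `F.L ^ c₁ ∣ M`), above the H-block height: `a′ + 1 ≤ c₁`
      {cg : ℕ} (_ : a' + 1 ≤ cg)
      -- the token's letters, `0 < B₃`, `a₀ ≤ a0OfP`, the (163)-type letter `θ_H` of the `H` doors
      {B₃ C θ Q a₀ a₁ θH : ℝ} (_ : 0 < B₃) (_ : 0 ≤ C) (_ : 0 ≤ θ) (_ : 0 ≤ Q) (_ : a₀ ≤ a0OfP F N Mc ρ B₁ c₁) (_ : 8 * CH * BH * Real.exp (-(δH * (ρ : ℝ))) ≤ θH)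
      -- V19's floor `2L² ≤ B₃` and the (162)–(166♭) smallness letters of the R0′ closers, `κ := b9OfP F Mc ρ B₁`
      (_ : 2 * (F.L : ℝ) ^ 2 ≤ B₃) (_ : 4 * C ≤ B₃) (_ : 16 * θ ≤ 1) (_ : (16 * Q + 1024 * b9OfP F Mc ρ B₁ ^ 2) * a₀ ≤ 1) (_ : 32 * b9OfP F Mc ρ B₁ * a₀ ≤ 1)
      -- the chart side's PER-LEVEL SIZE LETTERS, functions of the letters `(ε, δ)` and the level only
      (β₁ β₂ s' σ t₁ : (ℕ → ℝ) → (ℕ → ℝ) → ℕ → ℝ) (v av : (ℕ → ℝ) → (ℕ → ℝ) → ℕ → ℕ → ℝ)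
      -- ★ HLETTERS (RANGED): signs and the row budget, asked only IN THE TOKEN's RANGE `0 < δ_j ≤ a₁`, `B₃δ_j ≤ ε_j ≤ a₀`
      (_ : ∀ (K : ℕ) (ε δ : ℕ → ℝ) (j : ℕ), 0 < δ j → δ j ≤ a₁ → B₃ * δ j ≤ ε j → ε j ≤ a₀ →
        0 ≤ β₁ ε δ j ∧ 0 ≤ β₂ ε δ j ∧ 0 ≤ s' ε δ j ∧ σ ε δ j ≤ 1 / 2 ∧ (∀ i, 0 ≤ v ε δ j i) ∧ (∀ i, 0 ≤ av ε δ j i) ∧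
        (∀ i ≤ j, (((F.P K).d * ((sideP (F.P K) Mc ρ + 4 * ρ + 3) * (F.P K).L ^ (j - i)) : ℕ) : ℝ) * (v ε δ j i + av ε δ j i) ≤ σ ε δ j))
      -- ★ HBUDGET (RANGED): thresholds above the doors' floors summing below the token's threshold, IN THE TOKEN's RANGE
      (_ : ∀ (K : ℕ) (ε δ : ℕ → ℝ) (j : ℕ), 0 < δ j → δ j ≤ a₁ → B₃ * δ j ≤ ε j → ε j ≤ a₀ → ∃ t₂ t₃ tD : ℝ,
        1 / 4 * ((sideP (F.P K) Mc ρ : ℕ) : ℝ) * max (4 * CH * BH * β₁ ε δ j) (θH * β₂ ε δ j) < t₂ ∧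
        2 * CH * BH * s' ε δ j < t₃ ∧ 2 * CS * BS * (4 * σ ε δ j) < tD ∧
        t₁ ε δ j + (t₂ + tD) + t₃ ≤ C * δ j + θ * ε j + Q * ε j ^ 2)
      -- ★ HCHART-MEET: the chart lane's per-datum deliverable at PRINT's (150) FAMILY `D″`, owed ONLY at datums whose print box MEETS `Ω_{K−n}` within 3 and is CLEAN
      (_ : ∀ (ν : Stage7Numerics) (M : ℕ) (g : ℕ → ℝ) (K k : ℕ) (s : SeqOfRecord F ν M g K k), Sect2.SeqSeparated ν.M₁ s → 0 < ν.M₁ →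
        (c ≤ ν.M₁ ∧ k + c₀ ≤ F.m + K ∧ F.L ^ cg ∣ M ∧
          ∀ i, 1 ≤ i → i ≤ k → dCubeSide (F.P K).L M (RkOfRecord (F.P K).L ν.r (g i)) i ∣ (F.P K).sitesPerDir 0) → 1 ≤ k →
        ∀ (ε δ : ℕ → ℝ),
        (∀ n, n ≤ k → 0 < δ n ∧ δ n ≤ a₁) → (∀ n, n < k → δ n ≤ 2 * δ (n + 1)) → (∀ n, n < k → δ (n + 1) ≤ 2 * δ n) →
        (∀ n, n ≤ k → B₃ * δ n ≤ ε n ∧ ε n ≤ a₀) → (∀ n, n < k → ε n ≤ 2 * ε (n + 1)) → (∀ n, n < k → ε (n + 1) ≤ 2 * ε n) →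
        ∀ W : MSField (F.P K) (SU N), Sect2.DataSmall7PTop (avOfRecord F N K) s.Ω (suppDomOfRecord F ν K s.Ω) k δ W →
        ∀ U : GaugeField (F.P K) 0 (SU N),
        (∀ n, n ≤ k → PlaqSmallOn (Sect2.omegaPlaqsTop s.Ω (suppDomOfRecord F ν K s.Ω) n) (ε n * (F.P K).eta n ^ 2) U) →
        (∀ n, n ≤ k → Sect2.CoDivSmallOn (Sect2.omegaBondsTop s.Ω (suppDomOfRecord F ν K s.Ω) n) (ε n * (F.P K).eta n ^ 3) U) →
        AgreeOn (genSet s.Ω k) (avgFamily (avOfRecord F N K) U) W → IsCritOnFibre F N K (genSet s.Ω k) W U →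
        ∀ (n : ℕ) (hk : K - n ≤ (F.P K).m + (F.P K).K), 1 ≤ K - n → K - n ≤ k → ∀ (idx : Pt (F.P K).d),
        -- MEETING DATUMS ONLY (n07-e LOCATED-HCHART-UNANCHORED-IDX): the print box has a point within `3` of a lift of a site of `Ω_{K−n}`
        (∃ x ∈ box (F.P K).L (cornerP (F.P K) Mc ρ idx) (sideP (F.P K) Mc ρ) (K - n), ∃ y : Pt (F.P K).d, cover (F.P K) y ∈ s.Ω (K - n) ∧ Within ((3 : ℕ) : ℤ) x y) →
        -- CLEAN DATUMS ONLY (print p. 300 «□ intersecting Ω_j but not Ω_{j+1}»; n07-e LOCATED-INWARD-DATUM): top level, or the print box misses `Ω_{j+1}`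
        (K - n = k ∨ ∀ z ∈ box (F.P K).L (cornerP (F.P K) Mc ρ idx) (sideP (F.P K) Mc ρ) (K - n), cover (F.P K) z ∉ s.Ω (K - n + 1)) →
        -- THE FAMILY: print's (150) `Ω′_j = □_j (j < k), Ω′_k = □_k ∩ Ω_k` — the meet of the datum's cube tower with the record's regions (truncated at the datum's level)
        ∀ {HVd : Domains (F.P K)}
          (_ : HVd = domainsMeet (cubeDomains (F.P K) (cornerP (F.P K) Mc ρ idx) (sideP (F.P K) Mc ρ) ρ (K - n) hk) (domainsOfSeq s.Ω (K - n) hk))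
          (lo hi : ℕ → Pt (F.P K).d),
        lo 0 = (fun i => ((F.P K).L : ℤ) * (sqLo (F.P K).L (cornerP (F.P K) Mc ρ idx) ρ (K - n) 1 i - 1)) →
        hi 0 = (fun i => ((F.P K).L : ℤ) * (sqHi (F.P K).L (cornerP (F.P K) Mc ρ idx) (sideP (F.P K) Mc ρ) ρ (K - n) 1 i + 1) + (((F.P K).L : ℤ) - 1)) →
        (∀ j', 1 ≤ j' → lo j' = sqLo (F.P K).L (cornerP (F.P K) Mc ρ idx) ρ (K - n) j' - 1) →
        (∀ j', 1 ≤ j' → hi j' = sqHi (F.P K).L (cornerP (F.P K) Mc ρ idx) (sideP (F.P K) Mc ρ) ρ (K - n) j' + 1) →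
        ∃ HV : (BondIdx HVd → MatA N) →ₗ[ℂ] (PBond (F.P K) 0 → MatA N),
          (∀ (Bf : BondIdx HVd → MatA N) (b : PBond (F.P K) 0), HV Bf b = ∑ c, ((flatH (F.P K) (K - n) HVd (Pi.single c 1) b : ℝ) : ℂ) • Bf c) ∧
        ∀ (u : GaugeTransf (F.P K) 0 (SU N)) (A : PBond (F.P K) 0 → MatA N),
        (∀ b ∈ (Sect2.regionOfSet (F.P K) (cover (F.P K) '' box (F.P K).L (cornerP (F.P K) Mc ρ idx) (sideP (F.P K) Mc ρ) (K - n))).bonds,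
          gaugeU (fun x => ιSU N (u x)) (fun b' => ιSU N (U b')) b = expI ((F.P K).eta (K - n)) (A b)) →
        (∀ b ∈ (Sect2.regionOfSet (F.P K) (cover (F.P K) '' box (F.P K).L (cornerP (F.P K) Mc ρ idx) (sideP (F.P K) Mc ρ) (K - n))).bonds,
          ‖A b‖ < b9OfP F Mc ρ B₁ * ε (K - n)) →
        (∀ q ∈ (Sect2.regionOfSet (F.P K) (cover (F.P K) '' box (F.P K).L (cornerP (F.P K) Mc ρ idx) (sideP (F.P K) Mc ρ) (K - n))).dpairs,
          ‖grad ((F.P K).eta (K - n)) q.2.1 (fun y => A ⟨y, q.2.2⟩) q.1‖ < b9OfP F Mc ρ B₁ * ε (K - n)) →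
        (∀ b ∈ Sect2.bondsDeep (cover (F.P K) '' box (F.P K).L (cornerP (F.P K) Mc ρ idx) (sideP (F.P K) Mc ρ) (K - n)),
          ‖Sect2.codiffCurlA ((F.P K).eta (K - n)) A b.src b.dir‖ < b9OfP F Mc ρ B₁ * ε (K - n)) →
        (∀ b ∈ Sect2.bondsDeep (cover (F.P K) '' box (F.P K).L (cornerP (F.P K) Mc ρ idx) (sideP (F.P K) Mc ρ) (K - n)),
          ‖∑ ν' : Fin (F.P K).d, (((F.P K).eta (K - n) : ℝ) : ℂ)⁻¹ •
              (grad ((F.P K).eta (K - n)) ν' (fun y => A ⟨y, b.dir⟩) (b.src.unshift ν') - grad ((F.P K).eta (K - n)) ν' (fun y => A ⟨y, b.dir⟩) b.src)‖ <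
            b9OfP F Mc ρ B₁ * ε (K - n)) →
        (∀ D' : Domains (F.P K), LinearMap.ker (QpE D') ≤ LinearMap.ker (QpE HVd) → ∀ φ : MatA N →L[ℂ] ℂ,
          RE D' ((F.P K).eta (K - n))⁻¹ (dsE ((F.P K).eta (K - n))⁻¹ (WithLp.toLp 2 fun b => (φ (A b)).re : BondSpace (F.P K))) = 0 ∧
          RE D' ((F.P K).eta (K - n))⁻¹ (dsE ((F.P K).eta (K - n))⁻¹ (WithLp.toLp 2 fun b => (φ (A b)).im : BondSpace (F.P K))) = 0) →
        ∃ (xc : Pt (F.P K).d) (B B' : BondIdx HVd → MatA N) (A₁ : PBond (F.P K) 0 → MatA N)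
          (uL : GaugeTransf (F.P K) 0 (SU N)) (U₁ : GaugeField (F.P K) 0 (SU N)) (lam : (j : ℕ) → Site (F.P K) j → MatA N) (X : BondIdx HVd → MatA N),
          xc ∈ box (F.P K).L (cornerP (F.P K) Mc ρ idx) (sideP (F.P K) Mc ρ) (K - n) ∧
          -- near cells (print's `□″_k^{(k)} ∪ □′_k^{(k−1)}` + top cells: «level `K − n`, or source block in the next cube of the tower»): (160) CENTRED at `x_c`
          (∀ c : BondIdx HVd, ((c.1.1 : ℕ) = K - n ∨ blockOf c.1.2.src ∈ (cubeDomains (F.P K) (cornerP (F.P K) Mc ρ idx) (sideP (F.P K) Mc ρ) ρ (K - n) hk).Om ((c.1.1 : ℕ) + 1)) →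
            ‖B c‖ ≤ β₁ ε δ (K - n) * (distSite (Mk (F.P K) (c.1.1 : ℕ)) c.1.2.src (iterBlockOf (c.1.1 : ℕ) (cover (F.P K) xc)) + 1)) ∧
          -- far cells: (155) UNIFORM `β₂·(ρ + M′)`
          (∀ c : BondIdx HVd, ¬ ((c.1.1 : ℕ) = K - n ∨ blockOf c.1.2.src ∈ (cubeDomains (F.P K) (cornerP (F.P K) Mc ρ idx) (sideP (F.P K) Mc ρ) ρ (K - n) hk).Om ((c.1.1 : ℕ) + 1)) →
            ‖B c‖ ≤ β₂ ε δ (K - n) * ((ρ : ℝ) + ((sideP (F.P K) Mc ρ : ℕ) : ℝ))) ∧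
          (∀ c, ‖B' c‖ ≤ s' ε δ (K - n)) ∧
          (∀ j' ≤ K - n, ∀ c : PBond (F.P K) j', c.src ∈ (castSite '' Set.Icc (lo j') (hi j') : Set (Site (F.P K) j')) →
            c.tgt ∈ (castSite '' Set.Icc (lo j') (hi j') : Set (Site (F.P K) j')) →
              dist1 (Averaging.iter (avOfRecord F N K) j' (gaugeAct uL U₁) c) ≤ v ε δ (K - n) j') ∧
          (∀ j' ≤ K - n, ∀ c : PBond (F.P K) j', c.src ∈ (castSite '' Set.Icc (lo j') (hi j') : Set (Site (F.P K) j')) →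
            c.tgt ∈ (castSite '' Set.Icc (lo j') (hi j') : Set (Site (F.P K) j')) → dist1 (Averaging.iter (avOfRecord F N K) j' U₁ c) ≤ av ε δ (K - n) j') ∧
          (∀ (j' : ℕ) (y : Site (F.P K) j'), ‖lam j' y‖ ≤ ‖mlog (((((toMS uL j' (castSite (lo j')))⁻¹ * toMS uL j' y)⁻¹ : SU N)) : MatA N)‖) ∧
          (∀ c : BondIdx HVd, X c = LatticeFieldCalculus.grad (((F.P K).L : ℝ) ^ (K - n) / ((F.P K).L : ℝ) ^ (c.1.1 : ℕ)) (lam c.1.1) c.1.2) ∧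
          Letters10On (cover (F.P K) '' box (F.P K).L (cornerP (F.P K) Mc ρ idx) (sideP (F.P K) Mc ρ) (K - n)) ((F.P K).eta (K - n)) (t₁ ε δ (K - n)) A₁ ∧
          (∀ b, A b - HV X b = A₁ b + HV B b - HV B' b)),
      Prop8RegSepTopStepG F N (fun ν K Ω => suppDomOfRecord F ν K Ω)
        (fun ν M g K k _s => c ≤ ν.M₁ ∧ k + c₀ ≤ F.m + K ∧ F.L ^ cg ∣ M ∧
          ∀ i, 1 ≤ i → i ≤ k → dCubeSide (F.P K).L M (RkOfRecord (F.P K).L ν.r (g i)) i ∣ (F.P K).sitesPerDir 0) B₃ a₀ a₁ := by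
  obtain ⟨Mh₀, R₀, CS, BS, CH, δH, BH, hCS, hBS, hCH, hδH, hBH, hmain⟩ := prop8RegSepTopStepG_of_prop6P_of_chartMeet F N
  refine ⟨Mh₀, R₀, CS, BS, CH, δH, BH, hCS, hBS, hCH, hδH, hBH, ?_⟩
  intro B₁ c₁ hB₁ hc₁ ρ hP6 Mc Mh R a' hMc hMcρ hMha hMh hR hdvd hRρ hLρ c c₀ hc hc₀ hmc₀ hac₀ cg hacg B₃ C θ Q a₀ a₁ θH hB₃ hC0 hθ0 hQ0 ha₀ h163
    hB₃L hC hθ ha hκa β₁ β₂ s' σ t₁ v av hletters hbudget hchart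
  -- the grid guard implies the V20-G conjuncts (1–2) and the grid numerics (`hgran` from conjunct 3 with `L·L^{a′} ∣ L^{c₁}`, `hdiv` = conjunct 4)
  have hpow : F.L * Mh ∣ F.L ^ cg := by rw [hMha, ← pow_succ']; exact pow_dvd_pow F.L (by omega)
  exact hmain hB₁ hc₁ hP6 hMc hMcρ hMha hMh hR hdvd hRρ hLρ hc hc₀ hmc₀ hac₀ _ (fun ν M g K k s h => ⟨h.1, h.2.1⟩)
    (fun ν M g K k s h j hj1 hjk => ⟨(hpow.trans h.2.2.1).mul_right _, h.2.2.2 j hj1 hjk⟩)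
    hB₃ hC0 hθ0 hQ0 ha₀ h163 hB₃L hC hθ ha hκa β₁ β₂ s' σ t₁ v av hletters hbudget hchart

open scoped Classical in
/-- ★★★ **THE GRID-GUARDED STUB-1 SHAPE** (the V21-G CANDIDATE text's shape, plan g86 I.40244 (3), k0-s1-w3 FILE 4‴; NOT a registered stub): `∃ c c₀ c₁ B₃ a₀ a₁, 2L² ≤ B₃ ∧ 0 < a₀ ∧
0 < a₁ ∧ Prop8RegSepTopStepG F N suppDom (A‴ c c₀ c₁) B₃ a₀ a₁` modulo [6] Prop. 6, HCHART-MEET at the grid guard, the ranged HLETTERS ∕ HBUDGET, the smallness letters and the side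
letters (`a′ + 1 ≤ c₁` among them).  At `N = 2` and the plan's registration this would be the candidate stub text's inhabitant modulo the displayed hypotheses.
[cite: Balaban1985Variational, Prop. 8 p.304, (150) p.301, (162)–(168) pp.303–304; Balaban1985RegularSpaces, Prop. 6 p.99; Balaban1988Convergent, (2.1) p.254, (2.5) p.255] -/
theorem prop8StepCoPGridGuardShape_of_prop6P_of_chartMeet (F : T4Family) (N : ℕ) [NeZero N] :
    ∃ (Mh₀ R₀ : ℕ) (CS BS CH δH BH : ℝ), 0 ≤ CS ∧ 0 < BS ∧ 0 ≤ CH ∧ 0 < δH ∧ 0 < BH ∧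
    ∀ {B₁ c₁ : ℝ} (_ : 0 ≤ B₁) (_ : 0 < c₁) {ρ : ℕ}
      (_ : letI : CStarAlgebra (MatA N) := {}; B8.Prop6Printed 4 (F.L : ℝ) B₁ c₁ (fun i : ZdIdx 4 F.L => zdCubP (MatA N) F.L ρ i))
      -- structural letters: grid cube `Mc`, block height `a′` (`M_h = L^{a′} ≥ M_h⁰`), `R ≥ R₀`, the collar `ρ` with `L·M_h ∣ ρ`, `R·L·M_h ≤ ρ`, `L ≤ ρ`
      {Mc Mh R a' : ℕ} (_ : 1 ≤ Mc) (_ : Mc ≤ ρ) (_ : Mh = F.L ^ a') (_ : Mh₀ ≤ Mh) (_ : R₀ ≤ R) (_ : F.L * Mh ∣ ρ) (_ : R * (F.L * Mh) ≤ ρ) (hLρ : F.L ≤ ρ)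
      -- the two constants of the plan's V20-G guard `c ≤ ν.M₁ ∧ k + c₀ ≤ F.m + K` and their side conditions, stated once (n07-w3 g7's two + the head's two)
      {c c₀ : ℕ} (_ : (11 * 4 + 4 * ρ + Mc + 3) * F.L ≤ c) (_ : Mc + 11 * 4 + 6 * ρ ≤ 2 * F.L ^ c₀) (_ : F.m ≤ c₀) (_ : a' + 3 ≤ c₀)
      -- ★ THE GRID GUARD's third constant `c₁` (candidate conjunct `F.L ^ c₁ ∣ M`), above the H-block height: `a′ + 1 ≤ c₁`
      {cg : ℕ} (_ : a' + 1 ≤ cg)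
      -- the token's letters, `0 < B₃`, `a₀ ≤ a0OfP`, the (163)-type letter `θ_H` of the `H` doors
      {B₃ C θ Q a₀ a₁ θH : ℝ} (_ : 0 < B₃) (_ : 0 ≤ C) (_ : 0 ≤ θ) (_ : 0 ≤ Q) (_ : a₀ ≤ a0OfP F N Mc ρ B₁ c₁) (_ : 8 * CH * BH * Real.exp (-(δH * (ρ : ℝ))) ≤ θH)
      -- V19's floor `2L² ≤ B₃` and the (162)–(166♭) smallness letters of the R0′ closers, `κ := b9OfP F Mc ρ B₁`
      (_ : 2 * (F.L : ℝ) ^ 2 ≤ B₃) (_ : 4 * C ≤ B₃) (_ : 16 * θ ≤ 1) (_ : (16 * Q + 1024 * b9OfP F Mc ρ B₁ ^ 2) * a₀ ≤ 1) (_ : 32 * b9OfP F Mc ρ B₁ * a₀ ≤ 1) (_ : 0 < a₀) (_ : 0 < a₁)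
      -- the chart side's PER-LEVEL SIZE LETTERS, functions of the letters `(ε, δ)` and the level only
      (β₁ β₂ s' σ t₁ : (ℕ → ℝ) → (ℕ → ℝ) → ℕ → ℝ) (v av : (ℕ → ℝ) → (ℕ → ℝ) → ℕ → ℕ → ℝ)
      -- ★ HLETTERS (RANGED): signs and the row budget, asked only IN THE TOKEN's RANGE `0 < δ_j ≤ a₁`, `B₃δ_j ≤ ε_j ≤ a₀`
      (_ : ∀ (K : ℕ) (ε δ : ℕ → ℝ) (j : ℕ), 0 < δ j → δ j ≤ a₁ → B₃ * δ j ≤ ε j → ε j ≤ a₀ →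
        0 ≤ β₁ ε δ j ∧ 0 ≤ β₂ ε δ j ∧ 0 ≤ s' ε δ j ∧ σ ε δ j ≤ 1 / 2 ∧ (∀ i, 0 ≤ v ε δ j i) ∧ (∀ i, 0 ≤ av ε δ j i) ∧
        (∀ i ≤ j, (((F.P K).d * ((sideP (F.P K) Mc ρ + 4 * ρ + 3) * (F.P K).L ^ (j - i)) : ℕ) : ℝ) * (v ε δ j i + av ε δ j i) ≤ σ ε δ j))
      -- ★ HBUDGET (RANGED): thresholds above the doors' floors summing below the token's threshold, IN THE TOKEN's RANGE
      (_ : ∀ (K : ℕ) (ε δ : ℕ → ℝ) (j : ℕ), 0 < δ j → δ j ≤ a₁ → B₃ * δ j ≤ ε j → ε j ≤ a₀ → ∃ t₂ t₃ tD : ℝ,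
        1 / 4 * ((sideP (F.P K) Mc ρ : ℕ) : ℝ) * max (4 * CH * BH * β₁ ε δ j) (θH * β₂ ε δ j) < t₂ ∧
        2 * CH * BH * s' ε δ j < t₃ ∧ 2 * CS * BS * (4 * σ ε δ j) < tD ∧
        t₁ ε δ j + (t₂ + tD) + t₃ ≤ C * δ j + θ * ε j + Q * ε j ^ 2)
      -- ★ HCHART-MEET: the chart lane's per-datum deliverable at PRINT's (150) FAMILY `D″`, owed ONLY at datums whose print box MEETS `Ω_{K−n}` within 3 and is CLEAN
      (_ : ∀ (ν : Stage7Numerics) (M : ℕ) (g : ℕ → ℝ) (K k : ℕ) (s : SeqOfRecord F ν M g K k), Sect2.SeqSeparated ν.M₁ s → 0 < ν.M₁ →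
        (c ≤ ν.M₁ ∧ k + c₀ ≤ F.m + K ∧ F.L ^ cg ∣ M ∧
          ∀ i, 1 ≤ i → i ≤ k → dCubeSide (F.P K).L M (RkOfRecord (F.P K).L ν.r (g i)) i ∣ (F.P K).sitesPerDir 0) → 1 ≤ k →
        ∀ (ε δ : ℕ → ℝ),
        (∀ n, n ≤ k → 0 < δ n ∧ δ n ≤ a₁) → (∀ n, n < k → δ n ≤ 2 * δ (n + 1)) → (∀ n, n < k → δ (n + 1) ≤ 2 * δ n) →
        (∀ n, n ≤ k → B₃ * δ n ≤ ε n ∧ ε n ≤ a₀) → (∀ n, n < k → ε n ≤ 2 * ε (n + 1)) → (∀ n, n < k → ε (n + 1) ≤ 2 * ε n) →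
        ∀ W : MSField (F.P K) (SU N), Sect2.DataSmall7PTop (avOfRecord F N K) s.Ω (suppDomOfRecord F ν K s.Ω) k δ W →
        ∀ U : GaugeField (F.P K) 0 (SU N),
        (∀ n, n ≤ k → PlaqSmallOn (Sect2.omegaPlaqsTop s.Ω (suppDomOfRecord F ν K s.Ω) n) (ε n * (F.P K).eta n ^ 2) U) →
        (∀ n, n ≤ k → Sect2.CoDivSmallOn (Sect2.omegaBondsTop s.Ω (suppDomOfRecord F ν K s.Ω) n) (ε n * (F.P K).eta n ^ 3) U) →
        AgreeOn (genSet s.Ω k) (avgFamily (avOfRecord F N K) U) W → IsCritOnFibre F N K (genSet s.Ω k) W U →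
        ∀ (n : ℕ) (hk : K - n ≤ (F.P K).m + (F.P K).K), 1 ≤ K - n → K - n ≤ k → ∀ (idx : Pt (F.P K).d),
        -- MEETING DATUMS ONLY (n07-e LOCATED-HCHART-UNANCHORED-IDX): the print box has a point within `3` of a lift of a site of `Ω_{K−n}`
        (∃ x ∈ box (F.P K).L (cornerP (F.P K) Mc ρ idx) (sideP (F.P K) Mc ρ) (K - n), ∃ y : Pt (F.P K).d, cover (F.P K) y ∈ s.Ω (K - n) ∧ Within ((3 : ℕ) : ℤ) x y) →
        -- CLEAN DATUMS ONLY (print p. 300 «□ intersecting Ω_j but not Ω_{j+1}»; n07-e LOCATED-INWARD-DATUM): top level, or the print box misses `Ω_{j+1}`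
        (K - n = k ∨ ∀ z ∈ box (F.P K).L (cornerP (F.P K) Mc ρ idx) (sideP (F.P K) Mc ρ) (K - n), cover (F.P K) z ∉ s.Ω (K - n + 1)) →
        -- THE FAMILY: print's (150) `Ω′_j = □_j (j < k), Ω′_k = □_k ∩ Ω_k` — the meet of the datum's cube tower with the record's regions (truncated at the datum's level)
        ∀ {HVd : Domains (F.P K)}
          (_ : HVd = domainsMeet (cubeDomains (F.P K) (cornerP (F.P K) Mc ρ idx) (sideP (F.P K) Mc ρ) ρ (K - n) hk) (domainsOfSeq s.Ω (K - n) hk))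
          (lo hi : ℕ → Pt (F.P K).d),
        lo 0 = (fun i => ((F.P K).L : ℤ) * (sqLo (F.P K).L (cornerP (F.P K) Mc ρ idx) ρ (K - n) 1 i - 1)) →
        hi 0 = (fun i => ((F.P K).L : ℤ) * (sqHi (F.P K).L (cornerP (F.P K) Mc ρ idx) (sideP (F.P K) Mc ρ) ρ (K - n) 1 i + 1) + (((F.P K).L : ℤ) - 1)) →
        (∀ j', 1 ≤ j' → lo j' = sqLo (F.P K).L (cornerP (F.P K) Mc ρ idx) ρ (K - n) j' - 1) →
        (∀ j', 1 ≤ j' → hi j' = sqHi (F.P K).L (cornerP (F.P K) Mc ρ idx) (sideP (F.P K) Mc ρ) ρ (K - n) j' + 1) →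
        ∃ HV : (BondIdx HVd → MatA N) →ₗ[ℂ] (PBond (F.P K) 0 → MatA N),
          (∀ (Bf : BondIdx HVd → MatA N) (b : PBond (F.P K) 0), HV Bf b = ∑ c, ((flatH (F.P K) (K - n) HVd (Pi.single c 1) b : ℝ) : ℂ) • Bf c) ∧
        ∀ (u : GaugeTransf (F.P K) 0 (SU N)) (A : PBond (F.P K) 0 → MatA N),
        (∀ b ∈ (Sect2.regionOfSet (F.P K) (cover (F.P K) '' box (F.P K).L (cornerP (F.P K) Mc ρ idx) (sideP (F.P K) Mc ρ) (K - n))).bonds,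
          gaugeU (fun x => ιSU N (u x)) (fun b' => ιSU N (U b')) b = expI ((F.P K).eta (K - n)) (A b)) →
        (∀ b ∈ (Sect2.regionOfSet (F.P K) (cover (F.P K) '' box (F.P K).L (cornerP (F.P K) Mc ρ idx) (sideP (F.P K) Mc ρ) (K - n))).bonds,
          ‖A b‖ < b9OfP F Mc ρ B₁ * ε (K - n)) →
        (∀ q ∈ (Sect2.regionOfSet (F.P K) (cover (F.P K) '' box (F.P K).L (cornerP (F.P K) Mc ρ idx) (sideP (F.P K) Mc ρ) (K - n))).dpairs,
          ‖grad ((F.P K).eta (K - n)) q.2.1 (fun y => A ⟨y, q.2.2⟩) q.1‖ < b9OfP F Mc ρ B₁ * ε (K - n)) →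
        (∀ b ∈ Sect2.bondsDeep (cover (F.P K) '' box (F.P K).L (cornerP (F.P K) Mc ρ idx) (sideP (F.P K) Mc ρ) (K - n)),
          ‖Sect2.codiffCurlA ((F.P K).eta (K - n)) A b.src b.dir‖ < b9OfP F Mc ρ B₁ * ε (K - n)) →
        (∀ b ∈ Sect2.bondsDeep (cover (F.P K) '' box (F.P K).L (cornerP (F.P K) Mc ρ idx) (sideP (F.P K) Mc ρ) (K - n)),
          ‖∑ ν' : Fin (F.P K).d, (((F.P K).eta (K - n) : ℝ) : ℂ)⁻¹ •
              (grad ((F.P K).eta (K - n)) ν' (fun y => A ⟨y, b.dir⟩) (b.src.unshift ν') - grad ((F.P K).eta (K - n)) ν' (fun y => A ⟨y, b.dir⟩) b.src)‖ <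
            b9OfP F Mc ρ B₁ * ε (K - n)) →
        (∀ D' : Domains (F.P K), LinearMap.ker (QpE D') ≤ LinearMap.ker (QpE HVd) → ∀ φ : MatA N →L[ℂ] ℂ,
          RE D' ((F.P K).eta (K - n))⁻¹ (dsE ((F.P K).eta (K - n))⁻¹ (WithLp.toLp 2 fun b => (φ (A b)).re : BondSpace (F.P K))) = 0 ∧
          RE D' ((F.P K).eta (K - n))⁻¹ (dsE ((F.P K).eta (K - n))⁻¹ (WithLp.toLp 2 fun b => (φ (A b)).im : BondSpace (F.P K))) = 0) →
        ∃ (xc : Pt (F.P K).d) (B B' : BondIdx HVd → MatA N) (A₁ : PBond (F.P K) 0 → MatA N)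
          (uL : GaugeTransf (F.P K) 0 (SU N)) (U₁ : GaugeField (F.P K) 0 (SU N)) (lam : (j : ℕ) → Site (F.P K) j → MatA N) (X : BondIdx HVd → MatA N),
          xc ∈ box (F.P K).L (cornerP (F.P K) Mc ρ idx) (sideP (F.P K) Mc ρ) (K - n) ∧
          -- near cells (print's `□″_k^{(k)} ∪ □′_k^{(k−1)}` + top cells: «level `K − n`, or source block in the next cube of the tower»): (160) CENTRED at `x_c`
          (∀ c : BondIdx HVd, ((c.1.1 : ℕ) = K - n ∨ blockOf c.1.2.src ∈ (cubeDomains (F.P K) (cornerP (F.P K) Mc ρ idx) (sideP (F.P K) Mc ρ) ρ (K - n) hk).Om ((c.1.1 : ℕ) + 1)) →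
            ‖B c‖ ≤ β₁ ε δ (K - n) * (distSite (Mk (F.P K) (c.1.1 : ℕ)) c.1.2.src (iterBlockOf (c.1.1 : ℕ) (cover (F.P K) xc)) + 1)) ∧
          -- far cells: (155) UNIFORM `β₂·(ρ + M′)`
          (∀ c : BondIdx HVd, ¬ ((c.1.1 : ℕ) = K - n ∨ blockOf c.1.2.src ∈ (cubeDomains (F.P K) (cornerP (F.P K) Mc ρ idx) (sideP (F.P K) Mc ρ) ρ (K - n) hk).Om ((c.1.1 : ℕ) + 1)) →
            ‖B c‖ ≤ β₂ ε δ (K - n) * ((ρ : ℝ) + ((sideP (F.P K) Mc ρ : ℕ) : ℝ))) ∧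
          (∀ c, ‖B' c‖ ≤ s' ε δ (K - n)) ∧
          (∀ j' ≤ K - n, ∀ c : PBond (F.P K) j', c.src ∈ (castSite '' Set.Icc (lo j') (hi j') : Set (Site (F.P K) j')) →
            c.tgt ∈ (castSite '' Set.Icc (lo j') (hi j') : Set (Site (F.P K) j')) →
              dist1 (Averaging.iter (avOfRecord F N K) j' (gaugeAct uL U₁) c) ≤ v ε δ (K - n) j') ∧
          (∀ j' ≤ K - n, ∀ c : PBond (F.P K) j', c.src ∈ (castSite '' Set.Icc (lo j') (hi j') : Set (Site (F.P K) j')) →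
            c.tgt ∈ (castSite '' Set.Icc (lo j') (hi j') : Set (Site (F.P K) j')) → dist1 (Averaging.iter (avOfRecord F N K) j' U₁ c) ≤ av ε δ (K - n) j') ∧
          (∀ (j' : ℕ) (y : Site (F.P K) j'), ‖lam j' y‖ ≤ ‖mlog (((((toMS uL j' (castSite (lo j')))⁻¹ * toMS uL j' y)⁻¹ : SU N)) : MatA N)‖) ∧
          (∀ c : BondIdx HVd, X c = LatticeFieldCalculus.grad (((F.P K).L : ℝ) ^ (K - n) / ((F.P K).L : ℝ) ^ (c.1.1 : ℕ)) (lam c.1.1) c.1.2) ∧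
          Letters10On (cover (F.P K) '' box (F.P K).L (cornerP (F.P K) Mc ρ idx) (sideP (F.P K) Mc ρ) (K - n)) ((F.P K).eta (K - n)) (t₁ ε δ (K - n)) A₁ ∧
          (∀ b, A b - HV X b = A₁ b + HV B b - HV B' b)),
      ∃ (c' c₀' c₁' : ℕ) (B₃' a₀' a₁' : ℝ), 2 * (F.L : ℝ) ^ 2 ≤ B₃' ∧ 0 < a₀' ∧ 0 < a₁' ∧
        Prop8RegSepTopStepG F N (fun ν K Ω => suppDomOfRecord F ν K Ω)
          (fun ν M g K k _s => c' ≤ ν.M₁ ∧ k + c₀' ≤ F.m + K ∧ F.L ^ c₁' ∣ M ∧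
            ∀ i, 1 ≤ i → i ≤ k → dCubeSide (F.P K).L M (RkOfRecord (F.P K).L ν.r (g i)) i ∣ (F.P K).sitesPerDir 0) B₃' a₀' a₁' := by
  obtain ⟨Mh₀, R₀, CS, BS, CH, δH, BH, hCS, hBS, hCH, hδH, hBH, hmain⟩ := prop8RegSepTopStepG_gridGuard_of_prop6P_of_chartMeet F N
  refine ⟨Mh₀, R₀, CS, BS, CH, δH, BH, hCS, hBS, hCH, hδH, hBH, ?_⟩
  intro B₁ c₁ hB₁ hc₁ ρ hP6 Mc Mh R a' hMc hMcρ hMha hMh hR hdvd hRρ hLρ c c₀ hc hc₀ hmc₀ hac₀ cg hacg B₃ C θ Q a₀ a₁ θH hB₃ hC0 hθ0 hQ0 ha₀ h163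
    hB₃L hC hθ ha hκa ha₀' ha₁ β₁ β₂ s' σ t₁ v av hletters hbudget hchart
  exact ⟨c, c₀, cg, B₃, a₀, a₁, hB₃L, ha₀', ha₁, hmain hB₁ hc₁ hP6 hMc hMcρ hMha hMh hR hdvd hRρ hLρ hc hc₀ hmc₀ hac₀ hacg hB₃ hC0 hθ0 hQ0 ha₀ h163
    hB₃L hC hθ ha hκa β₁ β₂ s' σ t₁ v av hletters hbudget hchart⟩

end Summit.QuantumFields.YangMills.BalabanUVNodes.N07SplitClauseHeadKnitMeetGridGuard

end
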